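import Mathlib.Analysis.SpecialFunctions.Trigonometric.ArctanDeriv
import Mathlib.Analysis.SpecialFunctions.Log.Deriv
import Mathlib.Analysis.Calculus.Deriv.Polynomial
import Mathlib.Data.Nat.Choose.Sum
import Literature.Barriers.CriticalPhenomena.RigorousRGSmallParameterHHWGibbs
import Literature.Barriers.CriticalPhenomena.RigorousRGSmallParameterHHWTilt
import HarnessLib

/-!
# Newman's positivity (HHW (2.8)/(3.10), lower half) for lattice Lee–Yang laws, up to order 10

Hara–Hattori–Watanabe 2001 use, in §3 (Proposition 3.1) and §4, the inequalities
`μ_{2n,N} ≥ 0` ((2.8), [Newman 1975, Theorem 3]) for the truncated correlations of the block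
spin of the hierarchical Ising model and of its Gaussian tilts ((3.10): "`μ_n(t)` also is a
truncated `n` point correlation of a measure to which arguments in [15] apply"). This file
PROVES them for `n ≤ 5` — all that Proposition 3.1 consumes — for every magnetization law
`ν` of a finite FERROMAGNETIC Ising system with equal positive weights
(`isingMagnetizationLaw n J (fun _ => ω)`, `J ≥ 0`, `ω > 0`), by an elementary route that avoids
Hadamard's factorisation:

1. (`LeeYangTrigProduct`, from the tree's circle theorem) `ĥ(ξ) = cos(ωξ)^a ∏_{θ∈S}
   (1 - sin²(ωξ)/sin²(θ/2))`, `θ ∈ (0, π)`; with `B = (π - θ)/2 ∈ (0, π/2)` each factor is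
   `cos(B + ωξ)cos(B - ωξ)/cos²B`, so near `ξ = 0`
   `-log ĥ(ξ) = aΛ(ωξ) + Σ_θ [Λ(B_θ + ωξ) + Λ(B_θ - ωξ) - 2Λ(B_θ)]`, `Λ = -log cos`;
2. `Λ' = tan` and `tan' = 1 + tan²`, so `Λ^{(k+1)} = P_k(tan)` for the polynomials `P_0 = X`,
   `P_{k+1} = P_k'·(1 + X²)` (`tanPoly`), all of whose coefficients are `≥ 0`
   (`tanPoly_coeff_nonneg`); hence the even derivatives of `-log ĥ` at `0` are
   `ω^{2n}[a P_{2n-1}(0) + 2Σ_θ P_{2n-1}(tan B_θ)] ≥ 0` (`tan B_θ > 0`);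
3. the derivatives of `ĥ(ξ) = Σ_σ q_σ cos(ξ M_σ)` at `0` are the moments (`±m_{2j}`, `0`), and the
   Leibniz recursion for `ĥ' = -(-log ĥ)'·ĥ` (`leibniz_recursion`, abstract) identifies
   `(2n)!·μ_{2n}` (the moment polynomials `mu4`, `mu6`, `mu8`, `mu10` of
   `RigorousRGSmallParameterHHWReduction`/`…Tilt`) with those derivatives:
   `(2n)! μ_{2n} = (-log ĥ)^{(2n)}(0) ≥ 0` (`mu4_nonneg_of_ferro`, …, `mu10_nonneg_of_ferro`), and
   `μ_2 > 0` (`mu2_pos_of_ferro`).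
4. Application (`newmanPos_dbl_traj`, `stepHyp_traj`): the tilts `(S h_N)_t`, `t ≥ 0`, of the
   doubled trajectory law are again ferromagnetic magnetization laws with equal weights
   (`isingMagnetizationLaw_dbl`, `traj_eq_isingMagnetizationLaw` of `…HHWGibbs`), so `StepHyp`
   of `…HHWTilt` — the hypotheses of Proposition 3.1 — holds for `ν = traj s N`, `s > 0`, as soon
   as (3.13) `μ_{2,N} < 2 + √2` does; and `μ_{6,N}, μ_{8,N} ≥ 0` along the trajectory (`μ_{4,N} ≥ 0` is
   already `mu4_traj_nonneg` of `…HHWWindow`, via (A.1)).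

## References

* T. Hara, T. Hattori, H. Watanabe, Comm. Math. Phys. 220 (2001) 13–40, §2.2 (2.8)–(2.10),
  §3.2 (3.10), Appendix A (A.2)–(A.3).
* C. M. Newman, Comm. Math. Phys. 41 (1975) 1–9, Theorem 3 (positivity of `μ_{2n}`).
-/

noncomputable section

namespace Literature.Barriers.CriticalPhenomena

open _root_.MeasureTheory _root_.Filter _root_.Set _root_.Finset _root_.Polynomial
open scoped _root_.Topology BigOperators Polynomial

namespace HierarchicalRG

/-! ### The tangent polynomials `P_k`: `(-log cos)^{(k+1)} = P_k(tan)` -/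

/-- The tangent polynomials: `P_0 = X`, `P_{k+1} = P_k' · (1 + X²)`, so that
`d/dy P_k(tan y) = P_{k+1}(tan y)`. [folklore] -/
def tanPoly : ℕ → ℝ[X]
  | 0 => X
  | k + 1 => derivative (tanPoly k) * (1 + X ^ 2)

/-- `P_0 = X`. [folklore] -/
@[simp] theorem tanPoly_zero : tanPoly 0 = X := rfl

/-- `P_{k+1} = P_k'(1 + X²)`. [folklore] -/
theorem tanPoly_succ (k : ℕ) : tanPoly (k + 1) = derivative (tanPoly k) * (1 + X ^ 2) := rfl

/-- The coefficients of `1 + X²` are non-negative. [folklore] -/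
theorem coeff_one_add_X_sq_nonneg (i : ℕ) : 0 ≤ ((1 : ℝ[X]) + X ^ 2).coeff i := by
  rw [coeff_add, coeff_one, coeff_X_pow]
  split_ifs <;> norm_num

/-- A product of polynomials with non-negative coefficients has non-negative coefficients.
[folklore] -/
theorem coeff_mul_nonneg {p q : ℝ[X]} (hp : ∀ i, 0 ≤ p.coeff i) (hq : ∀ i, 0 ≤ q.coeff i) (i : ℕ) :
    0 ≤ (p * q).coeff i := by
  rw [coeff_mul]
  exact Finset.sum_nonneg fun x _ => mul_nonneg (hp _) (hq _)

/-- **All coefficients of the tangent polynomials are non-negative.** [folklore] -/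
theorem tanPoly_coeff_nonneg : ∀ (k i : ℕ), 0 ≤ (tanPoly k).coeff i
  | 0, i => by
    rw [tanPoly_zero, coeff_X]
    split_ifs <;> norm_num
  | k + 1, i => by
    rw [tanPoly_succ]
    refine coeff_mul_nonneg (fun j => ?_) coeff_one_add_X_sq_nonneg i
    rw [coeff_derivative]
    exact mul_nonneg (tanPoly_coeff_nonneg k _) (by positivity)

/-- A polynomial with non-negative coefficients is non-negative at non-negative arguments.
[folklore] -/
theorem eval_nonneg_of_coeff_nonneg {p : ℝ[X]} (hp : ∀ i, 0 ≤ p.coeff i) {u : ℝ} (hu : 0 ≤ u) :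
    0 ≤ p.eval u := by
  rw [eval_eq_sum_range]
  exact Finset.sum_nonneg fun i _ => mul_nonneg (hp i) (pow_nonneg hu i)

/-- `P_k(u) ≥ 0` for `u ≥ 0`. [folklore] -/
theorem tanPoly_eval_nonneg (k : ℕ) {u : ℝ} (hu : 0 ≤ u) : 0 ≤ (tanPoly k).eval u :=
  eval_nonneg_of_coeff_nonneg (tanPoly_coeff_nonneg k) hu

/-- `y ↦ P_k(tan y)`. [folklore] -/
def tanPolyTan (k : ℕ) (y : ℝ) : ℝ := (tanPoly k).eval (Real.tan y)

/-- `P_0(tan y) = tan y`. [folklore] -/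
@[simp] theorem tanPolyTan_zero (y : ℝ) : tanPolyTan 0 y = Real.tan y := by
  simp [tanPolyTan]

/-- **`d/dy P_k(tan y) = P_{k+1}(tan y)`** where `cos y ≠ 0` (`tan' = 1 + tan²`). [folklore] -/
theorem hasDerivAt_tanPoly_tan (k : ℕ) {y : ℝ} (hy : Real.cos y ≠ 0) :
    HasDerivAt (tanPolyTan k) (tanPolyTan (k + 1) y) y := by
  have h1 := ((tanPoly k).hasDerivAt (Real.tan y)).comp y (Real.hasDerivAt_tan hy)
  refine h1.congr_deriv ?_
  rw [tanPolyTan, tanPoly_succ, eval_mul, eval_add, eval_one, eval_pow, eval_X]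
  congr 1
  have := Real.one_add_tan_sq_mul_cos_sq_eq_one hy
  field_simp
  linarith

/-- `Λ = -log cos`. [folklore] -/
def negLogCos (y : ℝ) : ℝ := -Real.log (Real.cos y)

/-- **`d/dy (-log cos y) = tan y`** where `cos y > 0`. [folklore] -/
theorem hasDerivAt_negLogCos {y : ℝ} (hy : 0 < Real.cos y) :
    HasDerivAt negLogCos (Real.tan y) y := by
  have h := ((Real.hasDerivAt_log hy.ne').comp y (Real.hasDerivAt_cos y)).neg
  refine h.congr_deriv ?_
  rw [Real.tan_eq_sin_div_cos]
  field_simp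

/-! ### The Leibniz recursion for `f' = -g' f` -/

/-- **Leibniz recursion.** If `F_k' = F_{k+1}` and `G_k' = G_{k+1}` on an open set `U` and
`F_1 = -G_1 F_0` on `U` (i.e. `F_0 = e^{-G_0}` up to a constant), then for every `k`,
`F_{k+1} = -Σ_{j ≤ k} C(k,j) G_{j+1} F_{k-j}` on `U`. [folklore] -/
theorem leibniz_recursion {U : Set ℝ} (hU : IsOpen U) {F G : ℕ → ℝ → ℝ}
    (hF : ∀ k, ∀ x ∈ U, HasDerivAt (F k) (F (k + 1) x) x)
    (hG : ∀ k, ∀ x ∈ U, HasDerivAt (G k) (G (k + 1) x) x)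
    (h1 : ∀ x ∈ U, F 1 x = -(G 1 x * F 0 x)) (k : ℕ) :
    ∀ x ∈ U, F (k + 1) x =
      -∑ j ∈ Finset.range (k + 1), (k.choose j : ℝ) * (G (j + 1) x * F (k - j) x) := by
  induction k with
  | zero =>
    intro x hx
    simpa using h1 x hx
  | succ k ih =>
    intro x hx
    -- `H_k = F_{k+1} + Σ C(k,j) G_{j+1} F_{k-j}` vanishes on the open set `U` …
    set H : ℝ → ℝ := fun y => F (k + 1) y +
      ∑ j ∈ Finset.range (k + 1), (k.choose j : ℝ) * (G (j + 1) y * F (k - j) y) with hH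
    have hH0 : ∀ y ∈ U, H y = 0 := fun y hy => by
      rw [hH]; simp only; rw [ih y hy]; ring
    -- … so its derivative at `x` vanishes; the derivative is `H_{k+1}(x)` by Pascal's rule
    have hderiv : HasDerivAt H (F (k + 2) x +
        ∑ j ∈ Finset.range (k + 1), (k.choose j : ℝ) *
          (G (j + 2) x * F (k - j) x + G (j + 1) x * F (k - j + 1) x)) x := by
      refine (hF (k + 1) x hx).add (HasDerivAt.fun_sum fun j hj => ?_)
      have hkj : k - j + 1 = (k - j) + 1 := rfl
      exact ((hG (j + 1) x hx).mul (hF (k - j) x hx)).const_mul _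
    have hzero : HasDerivAt H 0 x := by
      have hev : H =ᶠ[𝓝 x] fun _ => 0 :=
        Filter.eventually_of_mem (hU.mem_nhds hx) fun y hy => hH0 y hy
      exact (hasDerivAt_const x (0 : ℝ)).congr_of_eventuallyEq hev
    have huniq := hderiv.unique hzero
    -- regroup with Pascal's rule
    have hpascal := Finset.sum_choose_succ_mul (fun i l => G (i + 1) x * F l x) k
    -- `hpascal : Σ_{i<k+2} C(k+1,i) G_{i+1} F_{k+1-i} = Σ_{i<k+1} C(k,i) G_{i+1} F_{k+1-i}
    --            + Σ_{i<k+1} C(k,i) G_{i+2} F_{k-i}`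
    rw [show k + 1 + 1 = k + 2 from rfl, hpascal]
    have hsplit : ∑ j ∈ Finset.range (k + 1), (k.choose j : ℝ) *
        (G (j + 2) x * F (k - j) x + G (j + 1) x * F (k - j + 1) x) =
        ∑ i ∈ Finset.range (k + 1), (k.choose i : ℝ) * (G (i + 1) x * F (k + 1 - i) x) +
        ∑ i ∈ Finset.range (k + 1), (k.choose i : ℝ) * (G (i + 1 + 1) x * F (k - i) x) := by
      rw [← Finset.sum_add_distrib]
      refine Finset.sum_congr rfl fun i hi => ?_
      have hi' : i ≤ k := Nat.lt_succ_iff.1 (Finset.mem_range.1 hi)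
      rw [show k + 1 - i = k - i + 1 by omega]
      ring
    rw [hsplit] at huniq
    linarith

/-! ### Multiset helpers -/

/-- Derivative of a multiset-indexed sum. [folklore] -/
theorem hasDerivAt_multiset_sum {ι : Type*} (S : Multiset ι) {A : ι → ℝ → ℝ} {A' : ι → ℝ}
    {x : ℝ} (h : ∀ i ∈ S, HasDerivAt (A i) (A' i) x) :
    HasDerivAt (fun y => (S.map fun i => A i y).sum) (S.map A').sum x := by
  induction S using Multiset.induction_on with
  | empty => simpa using hasDerivAt_const x (0 : ℝ)
  | cons a S ih =>
    have ha := h a (Multiset.mem_cons_self a S)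
    have hS := ih fun i hi => h i (Multiset.mem_cons_of_mem hi)
    have e : (fun y => (Multiset.map (fun i => A i y) (a ::ₘ S)).sum) =
        fun y => A a y + (Multiset.map (fun i => A i y) S).sum := by
      funext y; simp
    rw [e, Multiset.map_cons, Multiset.sum_cons]
    exact ha.add hS

/-- The logarithm of a multiset product of positive reals. [folklore] -/
theorem log_multiset_prod {ι : Type*} (S : Multiset ι) {f : ι → ℝ} (h : ∀ i ∈ S, 0 < f i) :
    Real.log (S.map f).prod = (S.map fun i => Real.log (f i)).sum := by
  induction S using Multiset.induction_on with
  | empty => simp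
  | cons a S ih =>
    have ha := h a (Multiset.mem_cons_self a S)
    have hS : ∀ i ∈ S, 0 < f i := fun i hi => h i (Multiset.mem_cons_of_mem hi)
    rw [Multiset.map_cons, Multiset.prod_cons, Multiset.map_cons, Multiset.sum_cons,
      Real.log_mul ha.ne' (Multiset.prod_pos fun b hb => ?_).ne', ih hS]
    obtain ⟨i, hi, rfl⟩ := Multiset.mem_map.1 hb
    exact hS i hi

/-- A uniform positive margin below finitely many positive reals. [folklore] -/
theorem exists_pos_le_of_multiset {ι : Type*} (S : Multiset ι) {f : ι → ℝ} (h : ∀ i ∈ S, 0 < f i)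
    {c : ℝ} (hc : 0 < c) : ∃ ρ : ℝ, 0 < ρ ∧ ρ ≤ c ∧ ∀ i ∈ S, ρ ≤ f i := by
  induction S using Multiset.induction_on with
  | empty => exact ⟨c, hc, le_rfl, fun i hi => absurd hi (Multiset.notMem_zero i)⟩
  | cons a S ih =>
    obtain ⟨ρ, hρ, hρc, hρS⟩ := ih fun i hi => h i (Multiset.mem_cons_of_mem hi)
    refine ⟨min ρ (f a), lt_min hρ (h a (Multiset.mem_cons_self a S)), (min_le_left _ _).trans hρc,
      fun i hi => ?_⟩
    rcases Multiset.mem_cons.1 hi with rfl | hi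
    · exact min_le_right _ _
    · exact (min_le_left _ _).trans (hρS i hi)

/-- From a multiset to a `Fin`-indexed family: products. [folklore] -/
theorem multiset_prod_map_eq_prod_fin {β : Type*} [CommMonoid β] (S : Multiset ℝ) (g : ℝ → β) :
    (S.map g).prod = ∏ i : Fin S.toList.length, g (S.toList.get i) := by
  conv_lhs => rw [← Multiset.coe_toList S]
  rw [Multiset.map_coe, Multiset.prod_coe, ← Fin.prod_ofFn]
  congr 1
  conv_lhs => rw [← List.ofFn_get S.toList]
  rw [List.map_ofFn]
  rfl

/-! ### Ferromagnetic magnetization laws with equal weights -/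

section Ferro

open Literature.Probability.LatticeModels
open _root_.Complex (I)

variable {n : ℕ} (J : Fin n → Fin n → ℝ) (ω : ℝ)

/-- The Gibbs probability `q_σ = e^{Σ Jσσ}/Z` of a configuration. [folklore] -/
def gibbsQ (σ : Fin n → Bool) : ℝ := isingBoltzmann J σ / isingPairPartition J

/-- The magnetization `M_σ = ω Σᵢ σᵢ` for equal weights `ω`. [folklore] -/
def magn (σ : Fin n → Bool) : ℝ := weightedMagnetization (fun _ => ω) σ

/-- `q_σ > 0`. [folklore] -/
theorem gibbsQ_pos (σ : Fin n → Bool) : 0 < gibbsQ J σ :=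
  div_pos (isingBoltzmann_pos J σ) (isingPairPartition_pos J)

/-- `Σ_σ q_σ = 1`. [folklore] -/
theorem sum_gibbsQ : ∑ σ, gibbsQ J σ = 1 := by
  simp only [gibbsQ, ← Finset.sum_div]
  exact div_self (isingPairPartition_pos J).ne'

/-- `M_σ = ω(2·#{σ = +} - n)`. [folklore] -/
theorem magn_eq (σ : Fin n → Bool) :
    magn ω σ = ω * (2 * ((Finset.univ.filter fun i => σ i = true).card : ℝ) - n) := by
  rw [magn, weightedMagnetization, ← sum_spinVal_eq, Finset.mul_sum]

/-- The moments of the law are the Gibbs averages of `M_σᵏ`. [folklore] -/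
theorem integral_pow_eq_sum (k : ℕ) :
    ∫ x, x ^ k ∂(isingMagnetizationLaw n J (fun _ => ω) : Measure ℝ) =
      ∑ σ, gibbsQ J σ * magn ω σ ^ k := by
  rw [integral_isingMagnetizationLaw J _ (g := fun x : ℝ => x ^ k) (by fun_prop)]
  rfl

/-- **The derivative family of `ĥ`**: `F_k(ξ) = Σ_σ q_σ M_σᵏ cos(ξM_σ + kπ/2)` (`F_0 = Re ĥ = ĥ`,
`F_k = ĥ^{(k)}`). [cite: HaraHattoriWatanabe2001, Appendix A eq. (A.2)] -/
def FF (k : ℕ) (ξ : ℝ) : ℝ :=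
  ∑ σ, gibbsQ J σ * magn ω σ ^ k * Real.cos (ξ * magn ω σ + k * (Real.pi / 2))

/-- `F_k' = F_{k+1}`. [folklore] -/
theorem hasDerivAt_FF (k : ℕ) (ξ : ℝ) : HasDerivAt (FF J ω k) (FF J ω (k + 1) ξ) ξ := by
  have h : HasDerivAt (FF J ω k) (∑ σ, gibbsQ J σ * magn ω σ ^ k *
      (-Real.sin (ξ * magn ω σ + k * (Real.pi / 2)) * (1 * magn ω σ))) ξ := by
    unfold FF
    refine HasDerivAt.fun_sum fun σ _ => ?_
    exact (((hasDerivAt_id' ξ).mul_const (magn ω σ)).add_const _).cos.const_mul _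
  refine h.congr_deriv (Finset.sum_congr rfl fun σ _ => ?_)
  rw [Nat.cast_succ, add_mul, one_mul (Real.pi / 2), ← add_assoc, Real.cos_add_pi_div_two]
  ring

/-- `F_{2j}(0) = (-1)ʲ m_{2j}`. [folklore] -/
theorem FF_even_zero (j : ℕ) :
    FF J ω (2 * j) 0 = (-1) ^ j * ∫ x, x ^ (2 * j) ∂(isingMagnetizationLaw n J (fun _ => ω) : Measure ℝ) := by
  rw [integral_pow_eq_sum, FF, Finset.mul_sum]
  refine Finset.sum_congr rfl fun σ _ => ?_
  have : (0 : ℝ) * magn ω σ + ((2 * j : ℕ) : ℝ) * (Real.pi / 2) = (j : ℕ) * Real.pi := by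
    push_cast; ring
  rw [this, Real.cos_nat_mul_pi]
  ring

/-- `F_{2j+1}(0) = 0`. [folklore] -/
theorem FF_odd_zero (j : ℕ) : FF J ω (2 * j + 1) 0 = 0 := by
  rw [FF]
  refine Finset.sum_eq_zero fun σ _ => ?_
  have : (0 : ℝ) * magn ω σ + ((2 * j + 1 : ℕ) : ℝ) * (Real.pi / 2) = (j : ℕ) * Real.pi + Real.pi / 2 := by
    push_cast; ring
  rw [this, Real.cos_add_pi_div_two, Real.sin_nat_mul_pi]
  ring

/-- `F_0(0) = 1`. [folklore] -/
theorem FF_zero_zero : FF J ω 0 0 = 1 := by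
  have := FF_even_zero J ω 0
  simp only [Nat.mul_zero, pow_zero, one_mul, integral_const, smul_eq_mul, mul_one] at this
  rw [this]
  simp

/-- The Laplace transform of the law is the exponential polynomial of a lattice law (masses `q_σ`
at `ω(2d - n)`, `d = #{+}`). [cite: LeeYang1952, Appendix II] -/
theorem integral_exp_eq_expPoly (z : ℂ) :
    ∫ u, Complex.exp (z * u) ∂(isingMagnetizationLaw n J (fun _ => ω) : Measure ℝ) =
      LeeYangTrig.expPoly (gibbsQ J)
        (fun σ => (Finset.univ.filter fun i => σ i = true).card) n ω z := by
  rw [integral_exp_isingMagnetizationLaw, isingFieldPartition, LeeYangTrig.expPoly, Finset.sum_div]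
  refine Finset.sum_congr rfl fun σ _ => ?_
  have hM : weightedMagnetization (fun _ => ω) σ =
      ω * (2 * ((Finset.univ.filter fun i => σ i = true).card : ℝ) - (n : ℕ)) := magn_eq ω σ
  rw [hM, gibbsQ]
  push_cast
  ring

/-- `F_0(ξ) = Re Σ_σ q_σ e^{iξM_σ}` is the real part of the exponential polynomial at `z = iξ`.
[folklore] -/
theorem FF_zero_eq_re (ξ : ℝ) :
    FF J ω 0 ξ = (LeeYangTrig.expPoly (gibbsQ J)
      (fun σ => (Finset.univ.filter fun i => σ i = true).card) n ω (ξ * I)).re := by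
  rw [LeeYangTrig.expPoly, Complex.re_sum, FF]
  refine Finset.sum_congr rfl fun σ _ => ?_
  have e : (ξ : ℂ) * I * (ω * (2 * (((Finset.univ.filter fun i => σ i = true).card : ℕ) : ℝ) - n)) =
      ((ξ * magn ω σ : ℝ) : ℂ) * I := by
    rw [magn_eq]; push_cast; ring
  rw [e, Complex.re_ofReal_mul, Complex.exp_ofReal_mul_I_re]
  simp

variable {J ω}

/-- **The finite trigonometric product** for a ferromagnetic law with equal weights `ω ≠ 0`:
`F_0(ξ) = cos(ξω)^a ∏ᵢ (1 - sin²(ξω)/sin²(θᵢ/2))`, `θᵢ ∈ (0, π)` (Lee–Yang, via the tree's circle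
theorem, and `LeeYangTrig.exists_trig_prod`). [cite: LeeYang1952, Appendix II]
[cite: HaraHattoriWatanabe2001, §2.2 eq. (2.9)] -/
theorem exists_FF_zero_eq_trigProd (hJ : ∀ i j, 0 ≤ J i j) (hω : 0 < ω) :
    ∃ (a K : ℕ) (θ : Fin K → ℝ), (∀ i, 0 < θ i ∧ θ i < Real.pi) ∧
      ∀ ξ : ℝ, FF J ω 0 ξ =
        Real.cos (ξ * ω) ^ a * ∏ i, (1 - Real.sin (ξ * ω) ^ 2 / Real.sin (θ i / 2) ^ 2) := by
  set c : (Fin n → Bool) → ℝ := gibbsQ J with hc_def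
  set deg : (Fin n → Bool) → ℕ := fun σ => (Finset.univ.filter fun i => σ i = true).card
    with hdeg_def
  have hc : ∀ σ, 0 < c σ := gibbsQ_pos J
  have hdeg : ∀ σ, deg σ ≤ n := fun σ => by
    simpa [hdeg_def] using Finset.card_filter_le (Finset.univ : Finset (Fin n)) _
  have hi₀ : deg (fun _ => false) = 0 := by simp [hdeg_def]
  have hi₁ : deg (fun _ => true) = n := by simp [hdeg_def]
  have hc1 : ∑ σ, c σ = 1 := sum_gibbsQ J
  have hLY : ∀ z : ℂ, LeeYangTrig.expPoly c deg n ω z = 0 → z.re = 0 := by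
    intro z hz
    refine hasLeeYangProperty_isingMagnetizationLaw_of_pos lee_yang_circle_theorem_finite_holds hJ
      (fun _ => hω) z ?_
    rw [integral_exp_eq_expPoly]
    exact hz
  obtain ⟨a, S, hS, -, hprod⟩ := LeeYangTrig.exists_trig_prod hc hdeg hi₀ hi₁ hc1 hω.ne' hLY
  refine ⟨a, S.toList.length, fun i => S.toList.get i, fun i => hS _ ?_, fun ξ => ?_⟩
  · rw [← Multiset.mem_toList]; exact List.get_mem _ _
  · rw [FF_zero_eq_re, hprod ξ, Complex.ofReal_re, multiset_prod_map_eq_prod_fin]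

/-! ### The logarithm of the trigonometric product near `ξ = 0` -/

/-- `B = (π - θ)/2`, so that `sin(θ/2) = cos B` and `B ∈ (0, π/2)` for `θ ∈ (0, π)`. [folklore] -/
def Bang (θ : ℝ) : ℝ := (Real.pi - θ) / 2

/-- **The derivative family of `g = -log F_0`**:
`G_0(ξ) = aΛ(ξω) + Σᵢ [Λ(Bᵢ + ξω) + Λ(Bᵢ - ξω) - 2Λ(Bᵢ)]` and, for `k ≥ 0`,
`G_{k+1}(ξ) = ω^{k+1}[a P_k(tan ξω) + Σᵢ (P_k(tan(Bᵢ + ξω)) + (-1)^{k+1} P_k(tan(Bᵢ - ξω)))]`.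
[cite: HaraHattoriWatanabe2001, Appendix A eq. (A.2)] -/
def GG (a : ℕ) {K : ℕ} (θ : Fin K → ℝ) (ω : ℝ) : ℕ → ℝ → ℝ
  | 0 => fun ξ => a * negLogCos (ξ * ω) +
      ∑ i, (negLogCos (Bang (θ i) + ξ * ω) + negLogCos (Bang (θ i) - ξ * ω) -
        2 * negLogCos (Bang (θ i)))
  | k + 1 => fun ξ => ω ^ (k + 1) * (a * tanPolyTan k (ξ * ω) +
      ∑ i, (tanPolyTan k (Bang (θ i) + ξ * ω) + (-1) ^ (k + 1) * tanPolyTan k (Bang (θ i) - ξ * ω)))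

/-- `G_{k+1}` unfolded. [folklore] -/
theorem GG_succ (a : ℕ) {K : ℕ} (θ : Fin K → ℝ) (ω : ℝ) (k : ℕ) (ξ : ℝ) :
    GG a θ ω (k + 1) ξ = ω ^ (k + 1) * (a * tanPolyTan k (ξ * ω) +
      ∑ i, (tanPolyTan k (Bang (θ i) + ξ * ω) +
        (-1) ^ (k + 1) * tanPolyTan k (Bang (θ i) - ξ * ω))) := rfl

section Log

variable {K : ℕ} {θ : Fin K → ℝ} (hθ : ∀ i, 0 < θ i ∧ θ i < Real.pi)
  {ρ : ℝ} (hρπ : ρ ≤ Real.pi / 2) (hρθ : ∀ i, ρ ≤ θ i / 2)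

/-- A uniform margin: `0 < ρ ≤ π/2`, `ρ ≤ θᵢ/2`. [folklore] -/
theorem exists_margin (hθ : ∀ i, 0 < θ i ∧ θ i < Real.pi) :
    ∃ ρ : ℝ, 0 < ρ ∧ ρ ≤ Real.pi / 2 ∧ ∀ i : Fin K, ρ ≤ θ i / 2 := by
  obtain ⟨ρ, hρ, hρc, hρS⟩ := exists_pos_le_of_multiset (Finset.univ : Finset (Fin K)).val
    (f := fun i => θ i / 2) (fun i _ => by linarith [(hθ i).1]) (c := Real.pi / 2)
    (by positivity)
  exact ⟨ρ, hρ, hρc, fun i => hρS i (Finset.mem_univ_val i)⟩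

include hθ hρθ in
/-- On `|x| < ρ` the cosines `cos(Bᵢ ± x)` are positive. [folklore] -/
theorem cos_pos_two {x : ℝ} (hx : |x| < ρ) (i : Fin K) :
    0 < Real.cos (Bang (θ i) + x) ∧ 0 < Real.cos (Bang (θ i) - x) := by
  have h1 := (abs_lt.1 hx).1
  have h2 := (abs_lt.1 hx).2
  have hB := hθ i
  have hρi := hρθ i
  refine ⟨Real.cos_pos_of_mem_Ioo ⟨?_, ?_⟩, Real.cos_pos_of_mem_Ioo ⟨?_, ?_⟩⟩ <;>
  · simp only [Bang]; linarith

include hθ in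
/-- `cos Bᵢ > 0`. [folklore] -/
theorem cos_Bang_pos (i : Fin K) : 0 < Real.cos (Bang (θ i)) := by
  have hB := hθ i
  refine Real.cos_pos_of_mem_Ioo ⟨?_, ?_⟩ <;>
  · simp only [Bang]; linarith

include hρπ in
/-- On `|x| < ρ ≤ π/2`, `cos x > 0`. [folklore] -/
theorem cos_pos_one {x : ℝ} (hx : |x| < ρ) : 0 < Real.cos x :=
  Real.cos_pos_of_mem_Ioo ⟨by linarith [(abs_lt.1 hx).1], by linarith [(abs_lt.1 hx).2]⟩

/-- The factor identity: `cos(B + x)cos(B - x)/cos²B = 1 - sin²x/sin²(θ/2)`, `B = (π - θ)/2`.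
[cite: LeeYang1952, Appendix II] -/
theorem factor_eq (θ₀ x : ℝ) (hc : Real.cos (Bang θ₀) ≠ 0) :
    Real.cos (Bang θ₀ + x) * Real.cos (Bang θ₀ - x) / Real.cos (Bang θ₀) ^ 2 =
      1 - Real.sin x ^ 2 / Real.sin (θ₀ / 2) ^ 2 := by
  have hs : Real.sin (θ₀ / 2) = Real.cos (Bang θ₀) := by
    rw [← Real.sin_pi_div_two_sub]; congr 1; simp only [Bang]; ring
  have hprod : Real.cos (Bang θ₀ + x) * Real.cos (Bang θ₀ - x) =
      Real.cos (Bang θ₀) ^ 2 - Real.sin x ^ 2 := by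
    rw [Real.cos_add, Real.cos_sub]
    have e₁ := Real.sin_sq_add_cos_sq x
    have e₂ := Real.sin_sq_add_cos_sq (Bang θ₀)
    linear_combination (Real.cos (Bang θ₀) ^ 2) * e₁ - (Real.sin x ^ 2) * e₂
  rw [hprod, hs]
  field_simp

include hθ hρπ hρθ in
/-- **`e^{-G_0} = ` the trigonometric product** on `|ξω| < ρ`. [cite: HaraHattoriWatanabe2001, §2.2 (2.6)] -/
theorem exp_neg_GG_zero (a : ℕ) (ω : ℝ) {ξ : ℝ} (hx : |ξ * ω| < ρ) :
    Real.exp (-GG a θ ω 0 ξ) =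
      Real.cos (ξ * ω) ^ a * ∏ i, (1 - Real.sin (ξ * ω) ^ 2 / Real.sin (θ i / 2) ^ 2) := by
  have hc0 := cos_pos_one hρπ hx
  have e : -GG a θ ω 0 ξ = (a : ℝ) * Real.log (Real.cos (ξ * ω)) +
      ∑ i, (Real.log (Real.cos (Bang (θ i) + ξ * ω)) + Real.log (Real.cos (Bang (θ i) - ξ * ω)) -
        (2 : ℕ) * Real.log (Real.cos (Bang (θ i)))) := by
    show -((a : ℝ) * negLogCos (ξ * ω) + ∑ i, (negLogCos (Bang (θ i) + ξ * ω) +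
      negLogCos (Bang (θ i) - ξ * ω) - 2 * negLogCos (Bang (θ i)))) = _
    simp only [negLogCos, neg_add, ← Finset.sum_neg_distrib]
    push_cast
    congr 1
    · ring
    · exact Finset.sum_congr rfl fun i _ => by ring
  rw [e, Real.exp_add, Real.exp_sum, Real.exp_nat_mul, Real.exp_log hc0]
  congr 1
  refine Finset.prod_congr rfl fun i _ => ?_
  obtain ⟨hcp, hcm⟩ := cos_pos_two hθ hρθ hx i
  have hcB := cos_Bang_pos hθ i
  rw [← factor_eq (θ i) (ξ * ω) hcB.ne', Real.exp_sub, Real.exp_add, Real.exp_nat_mul,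
    Real.exp_log hcp, Real.exp_log hcm, Real.exp_log hcB]

include hθ hρπ hρθ in
/-- **`G_k' = G_{k+1}`** on `|ξω| < ρ`. [folklore] -/
theorem hasDerivAt_GG (a : ℕ) (ω : ℝ) (k : ℕ) {ξ : ℝ} (hx : |ξ * ω| < ρ) :
    HasDerivAt (GG a θ ω k) (GG a θ ω (k + 1) ξ) ξ := by
  have hlin : HasDerivAt (fun y : ℝ => y * ω) (1 * ω) ξ := (hasDerivAt_id' ξ).mul_const ω
  have hc0 := cos_pos_one hρπ hx
  cases k with
  | zero =>
    -- `G_0' = G_1`: `Λ' = tan`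
    have hA := (hasDerivAt_negLogCos hc0).comp ξ hlin
    have hS : HasDerivAt (fun y => ∑ i, (negLogCos (Bang (θ i) + y * ω) +
        negLogCos (Bang (θ i) - y * ω) - 2 * negLogCos (Bang (θ i))))
        (∑ i, (Real.tan (Bang (θ i) + ξ * ω) * (1 * ω) +
          Real.tan (Bang (θ i) - ξ * ω) * (-(1 * ω)))) ξ := by
      refine HasDerivAt.fun_sum fun i _ => ?_
      obtain ⟨hcp, hcm⟩ := cos_pos_two hθ hρθ hx i
      exact (((hasDerivAt_negLogCos hcp).comp ξ (hlin.const_add _)).add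
        ((hasDerivAt_negLogCos hcm).comp ξ (hlin.const_sub _))).sub_const _
    have h := (hA.const_mul (a : ℝ)).add hS
    refine h.congr_deriv ?_
    rw [show (0 : ℕ) + 1 = 1 from rfl, GG_succ]
    simp only [tanPolyTan_zero, pow_one, zero_add, mul_add, Finset.mul_sum]
    congr 1
    · ring
    · exact Finset.sum_congr rfl fun i _ => by ring
  | succ k =>
    have hA := (hasDerivAt_tanPoly_tan k hc0.ne').comp ξ hlin
    have hS : HasDerivAt (fun y => ∑ i, (tanPolyTan k (Bang (θ i) + y * ω) +
        (-1) ^ (k + 1) * tanPolyTan k (Bang (θ i) - y * ω)))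
        (∑ i, (tanPolyTan (k + 1) (Bang (θ i) + ξ * ω) * (1 * ω) +
          (-1) ^ (k + 1) * (tanPolyTan (k + 1) (Bang (θ i) - ξ * ω) * (-(1 * ω))))) ξ := by
      refine HasDerivAt.fun_sum fun i _ => ?_
      obtain ⟨hcp, hcm⟩ := cos_pos_two hθ hρθ hx i
      exact ((hasDerivAt_tanPoly_tan k hcp.ne').comp ξ (hlin.const_add _)).add
        (((hasDerivAt_tanPoly_tan k hcm.ne').comp ξ (hlin.const_sub _)).const_mul _)
    have h := ((hA.const_mul (a : ℝ)).add hS).const_mul (ω ^ (k + 1))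
    refine h.congr_deriv ?_
    rw [GG_succ a θ ω (k + 1) ξ]
    rw [show ω ^ (k + 1 + 1) = ω ^ (k + 1) * ω by ring, mul_assoc]
    congr 1
    rw [mul_add, Finset.mul_sum]
    congr 1
    · ring
    · exact Finset.sum_congr rfl fun i _ => by ring

include hθ in
/-- **`G_{2m+2}(0) ≥ 0`**: `G_{2m}(0) = ω^{2m}[a P_{2m-1}(0) + 2Σᵢ P_{2m-1}(tan Bᵢ)]` with
`tan Bᵢ > 0` and `P` of non-negative coefficients. [cite: Newman1975, Theorem 3] -/
theorem GG_even_zero_nonneg (a : ℕ) (ω : ℝ) (m : ℕ) : 0 ≤ GG a θ ω (2 * m + 2) 0 := by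
  rw [show 2 * m + 2 = (2 * m + 1) + 1 from rfl, GG_succ]
  have hω : 0 ≤ ω ^ (2 * m + 1 + 1) := by
    rw [show 2 * m + 1 + 1 = 2 * (m + 1) by ring, pow_mul]; positivity
  have hsgn : (-1 : ℝ) ^ (2 * m + 1 + 1) = 1 := by
    rw [show 2 * m + 1 + 1 = 2 * (m + 1) by ring, pow_mul]; norm_num
  simp only [zero_mul, add_zero, sub_zero, hsgn, one_mul]
  refine mul_nonneg hω (add_nonneg (mul_nonneg (Nat.cast_nonneg a) ?_)
    (Finset.sum_nonneg fun i _ => ?_))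
  · rw [tanPolyTan, Real.tan_zero]
    exact tanPoly_eval_nonneg _ le_rfl
  · have htan : 0 < Real.tan (Bang (θ i)) := by
      have := hθ i
      exact Real.tan_pos_of_pos_of_lt_pi_div_two (by simp only [Bang]; linarith)
        (by simp only [Bang]; linarith)
    have := tanPoly_eval_nonneg (2 * m + 1) htan.le
    rw [tanPolyTan]
    linarith

end Log

/-! ### The truncated correlations are the even derivatives of `-log ĥ` at `0` -/

/-- **`(2n)!·μ_{2n} = G_{2n}(0)`, `n = 2, …, 5`**, for a ferromagnetic law with equal weights:
the Leibniz recursion for `F_0 = e^{-G_0}` near `0` solved against the moments.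
[cite: HaraHattoriWatanabe2001, Appendix A eq. (A.2)] -/
theorem exists_mu_eq_GG (hJ : ∀ i j, 0 ≤ J i j) (hω : 0 < ω) :
    ∃ (a K : ℕ) (θ : Fin K → ℝ), (∀ i, 0 < θ i ∧ θ i < Real.pi) ∧
      24 * mu4 (isingMagnetizationLaw n J (fun _ => ω) : Measure ℝ) = GG a θ ω 4 0 ∧
      720 * mu6 (isingMagnetizationLaw n J (fun _ => ω) : Measure ℝ) = GG a θ ω 6 0 ∧
      40320 * mu8 (isingMagnetizationLaw n J (fun _ => ω) : Measure ℝ) = GG a θ ω 8 0 ∧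
      3628800 * mu10 (isingMagnetizationLaw n J (fun _ => ω) : Measure ℝ) = GG a θ ω 10 0 := by
  set ν : Measure ℝ := (isingMagnetizationLaw n J (fun _ => ω) : Measure ℝ) with hν
  obtain ⟨a, K, θ, hθ, hprod⟩ := exists_FF_zero_eq_trigProd hJ hω
  obtain ⟨ρ, hρ, hρπ, hρθ⟩ := exists_margin hθ
  refine ⟨a, K, θ, hθ, ?_⟩
  -- the neighbourhood `U = {|ξω| < ρ}` of `0`
  set U : Set ℝ := {ξ | |ξ * ω| < ρ} with hU
  have hUo : IsOpen U := isOpen_lt (by fun_prop) continuous_const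
  have h0U : (0 : ℝ) ∈ U := by simpa [hU] using hρ
  -- `F_0 = e^{-G_0}` on `U`
  have hFG : ∀ ξ ∈ U, FF J ω 0 ξ = Real.exp (-GG a θ ω 0 ξ) := fun ξ hξ => by
    rw [hprod ξ, exp_neg_GG_zero hθ hρπ hρθ a ω hξ]
  -- `F_1 = -G_1 F_0` on `U`
  have h1 : ∀ ξ ∈ U, FF J ω 1 ξ = -(GG a θ ω 1 ξ * FF J ω 0 ξ) := by
    intro ξ hξ
    have hd := ((hasDerivAt_GG hθ hρπ hρθ a ω 0 hξ).neg).exp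
    have hev : FF J ω 0 =ᶠ[𝓝 ξ] fun y => Real.exp (-GG a θ ω 0 y) :=
      Filter.eventually_of_mem (hUo.mem_nhds hξ) fun y hy => hFG y hy
    have := (hasDerivAt_FF J ω 0 ξ).unique (hd.congr_of_eventuallyEq hev)
    have key : FF J ω 1 ξ = Real.exp (-GG a θ ω 0 ξ) * -GG a θ ω 1 ξ := by
      simpa only [Pi.neg_apply] using this
    rw [key, ← hFG ξ hξ]
    ring
  have hrec := leibniz_recursion hUo (F := FF J ω) (G := GG a θ ω)
    (fun k x _ => hasDerivAt_FF J ω k x) (fun k x hx => hasDerivAt_GG hθ hρπ hρθ a ω k hx) h1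
  -- the derivatives of `F` at `0` are the moments
  set m2 := ∫ x, x ^ 2 ∂ν with hm2
  set m4 := ∫ x, x ^ 4 ∂ν with hm4
  set m6 := ∫ x, x ^ 6 ∂ν with hm6
  set m8 := ∫ x, x ^ 8 ∂ν with hm8
  set m10 := ∫ x, x ^ 10 ∂ν with hm10
  have hF0 : FF J ω 0 0 = 1 := FF_zero_zero J ω
  have hF1 : FF J ω 1 0 = 0 := by simpa using FF_odd_zero J ω 0
  have hF3 : FF J ω 3 0 = 0 := by simpa using FF_odd_zero J ω 1
  have hF5 : FF J ω 5 0 = 0 := by simpa using FF_odd_zero J ω 2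
  have hF7 : FF J ω 7 0 = 0 := by simpa using FF_odd_zero J ω 3
  have hF9 : FF J ω 9 0 = 0 := by simpa using FF_odd_zero J ω 4
  have hF2 : FF J ω 2 0 = -m2 := by have := FF_even_zero J ω 1; norm_num at this; rw [hm2]; linarith
  have hF4 : FF J ω 4 0 = m4 := by have := FF_even_zero J ω 2; norm_num at this; rw [hm4]; linarith
  have hF6 : FF J ω 6 0 = -m6 := by have := FF_even_zero J ω 3; norm_num at this; rw [hm6]; linarith
  have hF8 : FF J ω 8 0 = m8 := by have := FF_even_zero J ω 4; norm_num at this; rw [hm8]; linarith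
  have hF10 : FF J ω 10 0 = -m10 := by
    have := FF_even_zero J ω 5; norm_num at this; rw [hm10]; linarith
  -- the recursion at `0`, orders 2, 4, 6, 8, 10
  have r1 := hrec 1 0 h0U
  have r3 := hrec 3 0 h0U
  have r5 := hrec 5 0 h0U
  have r7 := hrec 7 0 h0U
  have r9 := hrec 9 0 h0U
  simp only [Finset.sum_range_succ, Finset.sum_range_zero, zero_add] at r1 r3 r5 r7 r9
  norm_num [Nat.choose, hF0, hF1, hF2, hF3, hF4, hF5, hF6, hF7, hF8, hF9, hF10] at r1 r3 r5 r7 r9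
  have hG2 : GG a θ ω 2 0 = m2 := by linarith
  rw [hG2] at r3 r5 r7 r9
  have hG4 : GG a θ ω 4 0 = 3 * m2 ^ 2 - m4 := by linarith
  rw [hG4] at r5 r7 r9
  have hG6 : GG a θ ω 6 0 = 30 * m2 ^ 3 - 15 * m2 * m4 + m6 := by linarith
  rw [hG6] at r7 r9
  have hG8 : GG a θ ω 8 0 = 630 * m2 ^ 4 - 420 * m2 ^ 2 * m4 + 35 * m4 ^ 2 + 28 * m2 * m6 - m8 := by
    linarith
  rw [hG8] at r9
  have hG10 : GG a θ ω 10 0 = 22680 * m2 ^ 5 - 18900 * m2 ^ 3 * m4 + 1260 * m2 ^ 2 * m6 +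
      3150 * m2 * m4 ^ 2 - 45 * m2 * m8 - 210 * m4 * m6 + m10 := by
    linarith
  refine ⟨?_, ?_, ?_, ?_⟩
  · rw [hG4, mu4_eq]; ring
  · rw [hG6, mu6_eq_moments]; ring
  · rw [hG8, mu8_eq_moments]; ring
  · rw [hG10, mu10_eq_moments]; ring

/-- **Newman positivity, `μ_4 ≥ 0`**, for a ferromagnetic law with equal positive weights.
[cite: HaraHattoriWatanabe2001, §2.2 eq. (2.8)] [cite: Newman1975, Theorem 3] -/
theorem mu4_nonneg_of_ferro (hJ : ∀ i j, 0 ≤ J i j) (hω : 0 < ω) :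
    0 ≤ mu4 (isingMagnetizationLaw n J (fun _ => ω) : Measure ℝ) := by
  obtain ⟨a, K, θ, hθ, h4, -, -, -⟩ := exists_mu_eq_GG hJ hω
  have := GG_even_zero_nonneg hθ a ω 1
  norm_num at this
  linarith

/-- **Newman positivity, `μ_6 ≥ 0`**, for a ferromagnetic law with equal positive weights.
[cite: HaraHattoriWatanabe2001, §2.2 eq. (2.8)] [cite: Newman1975, Theorem 3] -/
theorem mu6_nonneg_of_ferro (hJ : ∀ i j, 0 ≤ J i j) (hω : 0 < ω) :
    0 ≤ mu6 (isingMagnetizationLaw n J (fun _ => ω) : Measure ℝ) := by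
  obtain ⟨a, K, θ, hθ, -, h6, -, -⟩ := exists_mu_eq_GG hJ hω
  have := GG_even_zero_nonneg hθ a ω 2
  norm_num at this
  linarith

/-- **Newman positivity, `μ_8 ≥ 0`**, for a ferromagnetic law with equal positive weights.
[cite: HaraHattoriWatanabe2001, §2.2 eq. (2.8)] [cite: Newman1975, Theorem 3] -/
theorem mu8_nonneg_of_ferro (hJ : ∀ i j, 0 ≤ J i j) (hω : 0 < ω) :
    0 ≤ mu8 (isingMagnetizationLaw n J (fun _ => ω) : Measure ℝ) := by
  obtain ⟨a, K, θ, hθ, -, -, h8, -⟩ := exists_mu_eq_GG hJ hω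
  have := GG_even_zero_nonneg hθ a ω 3
  norm_num at this
  linarith

/-- **Newman positivity, `μ_10 ≥ 0`**, for a ferromagnetic law with equal positive weights.
[cite: HaraHattoriWatanabe2001, §2.2 eq. (2.8)] [cite: Newman1975, Theorem 3] -/
theorem mu10_nonneg_of_ferro (hJ : ∀ i j, 0 ≤ J i j) (hω : 0 < ω) :
    0 ≤ mu10 (isingMagnetizationLaw n J (fun _ => ω) : Measure ℝ) := by
  obtain ⟨a, K, θ, hθ, -, -, -, h10⟩ := exists_mu_eq_GG hJ hω
  have := GG_even_zero_nonneg hθ a ω 4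
  norm_num at this
  linarith

/-- **`μ_2 > 0`** for a law with equal positive weights and at least one spin (`μ_2 = m_2/2`,
`m_2 ≥ q_{+…+} (nω)² > 0`). [cite: HaraHattoriWatanabe2001, §2.3 (observation (2))] -/
theorem mu2_pos_of_ferro (hn : 0 < n) (hω : 0 < ω) :
    0 < mu2 (isingMagnetizationLaw n J (fun _ => ω) : Measure ℝ) := by
  rw [mu2_eq, integral_pow_eq_sum]
  have hle : gibbsQ J (fun _ => true) * magn ω (fun _ : Fin n => true) ^ 2 ≤
      ∑ σ, gibbsQ J σ * magn ω σ ^ 2 :=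
    Finset.single_le_sum (f := fun σ => gibbsQ J σ * magn ω σ ^ 2)
      (fun σ _ => mul_nonneg (gibbsQ_pos J σ).le (sq_nonneg _)) (Finset.mem_univ _)
  have hM : magn ω (fun _ : Fin n => true) = ω * n := by
    rw [magn_eq]
    rw [Finset.filter_true_of_mem (fun _ _ => rfl), Finset.card_univ, Fintype.card_fin]
    ring
  have hpos : 0 < gibbsQ J (fun _ => true) * magn ω (fun _ : Fin n => true) ^ 2 := by
    rw [hM]
    have : 0 < (n : ℝ) := by exact_mod_cast hn
    exact mul_pos (gibbsQ_pos J _) (by positivity)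
  linarith

end Ferro

/-! ### Odd moments of magnetization laws vanish (spin flip) -/

section Flip

open Literature.Probability.LatticeModels

/-- **Odd moments vanish**: `∫ xʲ d(law) = 0` for odd `j`, by the spin flip `σ ↦ -σ` (which
preserves the energy and negates the magnetization). [cite: HaraHattoriWatanabe2001, §2.2 eq. (2.10)] -/
theorem integral_pow_odd_isingMagnetizationLaw {n : ℕ} (J : Fin n → Fin n → ℝ) (w : Fin n → ℝ)
    {j : ℕ} (hj : Odd j) :
    ∫ x, x ^ j ∂(isingMagnetizationLaw n J w : Measure ℝ) = 0 := by
  rw [integral_isingMagnetizationLaw J w (g := fun x : ℝ => x ^ j) (by fun_prop)]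
  set e : (Fin n → Bool) ≃ (Fin n → Bool) := Function.Involutive.toPerm
    (fun σ : Fin n → Bool => fun i => !σ i) (fun σ => by funext i; simp) with he
  have hflip : ∀ σ : Fin n → Bool, e σ = fun i => !σ i := fun σ => rfl
  have hsum : ∑ σ, isingBoltzmann J σ / isingPairPartition J * (weightedMagnetization w σ) ^ j =
      ∑ σ, isingBoltzmann J (e σ) / isingPairPartition J * (weightedMagnetization w (e σ)) ^ j :=
    (Fintype.sum_equiv e _ _ fun σ => rfl).symm
  have hneg : ∀ σ, isingBoltzmann J (e σ) / isingPairPartition J * (weightedMagnetization w (e σ)) ^ j =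
      -(isingBoltzmann J σ / isingPairPartition J * (weightedMagnetization w σ) ^ j) := fun σ => by
    rw [hflip, isingBoltzmann, isingPairEnergy_flip, weightedMagnetization_flip, hj.neg_pow]
    rw [isingBoltzmann]
    ring
  simp only [hneg, Finset.sum_neg_distrib] at hsum
  linarith

end Flip

/-! ### Application to the hierarchical trajectory -/

section Traj

open Literature.Probability.LatticeModels

/-- **The tilts of the doubled trajectory law are ferromagnetic magnetization laws with equal
weights**: `(S h_N)_t` is the law of the block spin of `2^{N+1}` spins with couplings
`J⁽ᴺ⁾ ⊕ J⁽ᴺ⁾ + t X²_{N+1}` and weights `s(√c/2)^{N+1}` (the doubling identity of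
`RigorousRGSmallParameterHHWGibbs`). [cite: HaraHattoriWatanabe2001, §1 eq. (1.2), §2.2 eq. (2.9)] -/
theorem sqTilt_dbl_traj_eq (s : ℝ) (N : ℕ) (t : ℝ) :
    sqTilt (dbl (traj s N)) t =
      (isingMagnetizationLaw (2 ^ (N + 1))
        (dblCoupling (splitEquiv N) (hierCoupling s N) t hierK (hierWeight s N))
        (hierWeight s (N + 1)) : Measure ℝ) := by
  rw [sqTilt, dbl, traj_eq_isingMagnetizationLaw, ← dblWeight_hierWeight, isingMagnetizationLaw_dbl]
  rfl

/-- The weights are all equal to `s(√c/2)^N`. [folklore] -/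
theorem hierWeight_eq (s : ℝ) (N : ℕ) : hierWeight s N = fun _ => s * hierK ^ N := rfl

/-- The top-level couplings are ferromagnetic for `t ≥ 0`. [folklore] -/
theorem dblCoupling_traj_nonneg (s : ℝ) (N : ℕ) {t : ℝ} (ht : 0 ≤ t) (a b : Fin (2 ^ (N + 1))) :
    0 ≤ dblCoupling (splitEquiv N) (hierCoupling s N) t hierK (hierWeight s N) a b :=
  dblCoupling_nonneg _ (hierCoupling_nonneg s N) ht _ (fun _ _ => mul_self_nonneg _) a b

/-- **Newman positivity along the tilted flow of Proposition 3.1** ((3.10)): for `s > 0` and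
every `T`, the tilts `(S h_N)_t`, `0 ≤ t ≤ T`, have `μ_2 > 0` and `μ_4, μ_6, μ_8, μ_10 ≥ 0`.
[cite: HaraHattoriWatanabe2001, §3.2 eq. (3.10)] [cite: Newman1975, Theorem 3] -/
theorem newmanPos_dbl_traj {s : ℝ} (hs : 0 < s) (N : ℕ) (T : ℝ) : NewmanPos (dbl (traj s N)) T := by
  have hω : 0 < s * hierK ^ (N + 1) := mul_pos hs (pow_pos hierK_pos _)
  refine ⟨fun t ht => ?_, fun t ht => ?_, fun t ht => ?_, fun t ht => ?_, fun t ht => ?_⟩ <;>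
    rw [sqTilt_dbl_traj_eq, hierWeight_eq]
  · exact mu2_pos_of_ferro (pow_pos two_pos _) hω
  · exact mu4_nonneg_of_ferro (dblCoupling_traj_nonneg s N ht.1) hω
  · exact mu6_nonneg_of_ferro (dblCoupling_traj_nonneg s N ht.1) hω
  · exact mu8_nonneg_of_ferro (dblCoupling_traj_nonneg s N ht.1) hω
  · exact mu10_nonneg_of_ferro (dblCoupling_traj_nonneg s N ht.1) hω

/-- **`μ_{2,N} > 0`** along the trajectory (`s > 0`). [cite: HaraHattoriWatanabe2001, §2.3 (observation (2))] -/
theorem mu2_traj_pos {s : ℝ} (hs : 0 < s) (N : ℕ) : 0 < mu2 (traj s N) := by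
  rw [traj_eq_isingMagnetizationLaw, hierWeight_eq]
  exact mu2_pos_of_ferro (pow_pos two_pos _) (mul_pos hs (pow_pos hierK_pos _))

/-- **`μ_{6,N} ≥ 0`** along the trajectory (`s > 0`): (2.8) for `n = 3`.
[cite: HaraHattoriWatanabe2001, §2.2 eq. (2.8)] -/
theorem mu6_traj_nonneg {s : ℝ} (hs : 0 < s) (N : ℕ) : 0 ≤ mu6 (traj s N) := by
  rw [traj_eq_isingMagnetizationLaw, hierWeight_eq]
  exact mu6_nonneg_of_ferro (hierCoupling_nonneg s N) (mul_pos hs (pow_pos hierK_pos _))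

/-- **`μ_{8,N} ≥ 0`** along the trajectory (`s > 0`): (2.8) for `n = 4`.
[cite: HaraHattoriWatanabe2001, §2.2 eq. (2.8)] -/
theorem mu8_traj_nonneg {s : ℝ} (hs : 0 < s) (N : ℕ) : 0 ≤ mu8 (traj s N) := by
  rw [traj_eq_isingMagnetizationLaw, hierWeight_eq]
  exact mu8_nonneg_of_ferro (hierCoupling_nonneg s N) (mul_pos hs (pow_pos hierK_pos _))

/-- Odd moments of `h_N` vanish (`h_N` is symmetric). [cite: HaraHattoriWatanabe2001, §2.2 eq. (2.10)] -/
theorem integral_pow_odd_traj (s : ℝ) (N : ℕ) {j : ℕ} (hj : Odd j) :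
    ∫ x, x ^ j ∂(traj s N) = 0 := by
  rw [traj_eq_isingMagnetizationLaw]
  exact integral_pow_odd_isingMagnetizationLaw _ _ hj

/-- **The hypotheses of Proposition 3.1 hold along the trajectory** (`s > 0`) as soon as (3.13)
`μ_{2,N} < 2 + √2` does: boundedness, symmetry, Newman positivity of the tilted doubled law,
`μ_{2,N} > 0`. [cite: HaraHattoriWatanabe2001, Proposition 3.1] -/
theorem stepHyp_traj {s : ℝ} (hs : 0 < s) (N : ℕ) (h313 : mu2 (traj s N) < 2 + Real.sqrt 2) :
    StepHyp (traj s N) :=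
  { bdd := isBddLaw_traj s N
    odd := fun _ hj => integral_pow_odd_traj s N hj
    pos := newmanPos_dbl_traj hs N _
    two_pos := mu2_traj_pos hs N
    subcrit := h313 }

end Traj

end HierarchicalRG

end Literature.Barriers.CriticalPhenomena
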